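import Summits.KontsevichZagierPeriods.KontsevichZagierPeriods.Theorems.LinRedNormalFormArrangementNormalFormSeparateAllHHMass
import Summits.KontsevichZagierPeriods.KontsevichZagierPeriods.Theorems.LinRedNormalFormArrangementNormalFormSeparateAllHHChart
import Summits.KontsevichZagierPeriods.KontsevichZagierPeriods.Theorems.LinRedNormalFormArrangementNormalFormSeparateTwoHIWeight

/-!
# The weight on a nested thin sector of any depth: fibre-mass hypotheses and weight algebra

(Line `janus-bands`, crux `ArrangementNormalForm`, stub `stub_separateHigh_hH`, part `AllHHWeight` of
the dimension-generic wall-invariant termwise-split lemma, base dimension `b + 1 ≥ 4` with fibres;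
namespace `SepAll`.)
For a literal Janus fibre datum (`lo`, `hi`, `a` over atoms `SepTwo.Atm D`) and a nested thin
sector at the base point `z₁ ∈ ℝ^D` with frame `f` (part `AllHHChart`), every atom value along the
sector is the nested value `SepAll.nval` of part `AllHHMass` (`av_npt`); hence the fibre mass in
blown-up coordinates `Λ'(w) = lmass lo hi a (av (z₁ + npt f w))` is, on all small boxes, almost
decreasing towards the corner at ratio `4` and has a logarithmic contraction cost in every single
coordinate (`weight_hyps`, registered as `separateAllHH_weight`; common separation constant
`exists_sep_family`). The full weight of the ray theorem is
`wt Dv ω Λ' w = ofReal (jac w / (w^{Dv} |ω w|)) · Λ' w` with a two-sided bounded regular factor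
`ω`; this file also proves its ratio-`4` monotonicity (`wt_mono`) and its logarithmic cost in the
coordinates carrying no explicit power (`wt_log`), and the pointwise conversion `piece_eq_wt`.
-/

noncomputable section

open Set Finset MeasureTheory Function
open scoped ENNReal

namespace Summit.KontsevichZagierPeriods.ArrangementNormalForm.JanusBands

namespace SepAll

open SepTwo

variable {k D : ℕ}

/-! ### Atoms along a nested sector -/

/-- The linear part of an atom on a vector. -/
def alin (c : Atm D) (v : Fin D → ℝ) : ℝ := ∑ i, (c.1 i : ℝ) * v i

/-- Atom values are affine. -/
theorem av_add (x y : Fin D → ℝ) (c : Atm D) : av (x + y) c = av x c + alin c y := by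
  simp only [av, alin, Pi.add_apply, mul_add, sum_add_distrib]
  ring

/-- The linear part is linear. -/
theorem alin_sum_smul (c : Atm D) {ι : Type*} (s : Finset ι) (r : ι → ℝ) (v : ι → Fin D → ℝ) :
    alin c (∑ l ∈ s, r l • v l) = ∑ l ∈ s, r l * alin c (v l) := by
  simp only [alin, Finset.sum_apply, Pi.smul_apply, smul_eq_mul, Finset.mul_sum]
  rw [Finset.sum_comm]
  refine Finset.sum_congr rfl fun l _ => Finset.sum_congr rfl fun i _ => ?_
  ring

/-- **Atom values along a nested thin sector are nested values.** -/
theorem av_npt (z₁ : Fin D → ℝ) (f : Fin D → Fin D → ℝ) (w : Fin D → ℝ) (c : Atm D) :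
    av (z₁ + npt f w) c = nval (fun c => av z₁ c) (fun l c => alin c (f l)) w c := by
  rw [av_add, nval, npt, alin_sum_smul]

/-- The valuation along the sector as a function. -/
theorem av_npt_eq (z₁ : Fin D → ℝ) (f : Fin D → Fin D → ℝ) (w : Fin D → ℝ) :
    av (z₁ + npt f w) = nval (fun c => av z₁ c) (fun l c => alin c (f l)) w :=
  funext fun c => av_npt z₁ f w c

/-- **The fibre mass along a nested sector is measurable.** -/
theorem measurable_lmass_npt (lo hi : Fin k → Fin k ⊕ Atm D) (a : Fin k → Option (Atm D))
    (z₁ : Fin D → ℝ) (f : Fin D → Fin D → ℝ) :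
    Measurable fun w : Fin D → ℝ => lmass lo hi a (av (z₁ + npt f w)) :=
  (measurable_lmass_av lo hi a).comp (continuous_const.add (continuous_npt f)).measurable

/-! ### Constants -/

/-- **Common separation constant** for a value function and a finite family of slope functions. -/
theorem exists_sep_family {ι : Type*} (U : Finset ι) (c₀ : ι → ℝ) (P : Fin D → ι → ℝ) :
    ∃ g : ℝ, 0 < g ∧ (∀ c ∈ U, ∀ c' ∈ U, c₀ c ≠ c₀ c' → g ≤ |c₀ c - c₀ c'|) ∧
      ∀ l, ∀ c ∈ U, ∀ c' ∈ U, P l c ≠ P l c' → g ≤ |P l c - P l c'| := by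
  obtain ⟨G, hG, hGsep⟩ := exists_sep_const U c₀
  choose gP hgP hgPsep using fun l => exists_sep_const U (P l)
  by_cases hD : D = 0
  · subst hD
    exact ⟨G, hG, hGsep, fun l => l.elim0⟩
  have hne : (Finset.univ : Finset (Fin D)).Nonempty :=
    Finset.univ_nonempty_iff.2 (Fin.pos_iff_nonempty.1 (Nat.pos_of_ne_zero hD))
  set g₁ : ℝ := Finset.univ.inf' hne gP with hg₁
  have hg₁le : ∀ l, g₁ ≤ gP l := fun l => Finset.inf'_le _ (Finset.mem_univ l)
  have hg₁pos : 0 < g₁ := by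
    obtain ⟨l, -, hl⟩ := Finset.exists_mem_eq_inf' hne gP
    rw [hg₁, hl]; exact hgP l
  refine ⟨min G g₁, lt_min hG hg₁pos, fun c hc c' hc' h => (min_le_left _ _).trans (hGsep c hc c' hc' h),
    fun l c hc c' hc' h => ((min_le_right _ _).trans (hg₁le l)).trans (hgPsep l c hc c' hc' h)⟩

/-- **Common bound** for a finite family of slope functions on a finite set. -/
theorem exists_bound_family {ι : Type*} (U : Finset ι) (P : Fin D → ι → ℝ) :
    ∃ R : ℝ, 0 < R ∧ ∀ l, ∀ c ∈ U, |P l c| ≤ R := by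
  refine ⟨1 + ∑ l, ∑ c ∈ U, |P l c|, by positivity, fun l c hc => ?_⟩
  have h1 : |P l c| ≤ ∑ c' ∈ U, |P l c'| :=
    Finset.single_le_sum (f := fun c' => |P l c'|) (fun _ _ => abs_nonneg _) hc
  have h2 : ∑ c' ∈ U, |P l c'| ≤ ∑ l', ∑ c' ∈ U, |P l' c'| :=
    Finset.single_le_sum (f := fun l' => ∑ c' ∈ U, |P l' c'|)
      (fun _ _ => Finset.sum_nonneg fun _ _ => abs_nonneg _) (Finset.mem_univ l)
  linarith

/-! ### The fibre-mass hypotheses -/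

/-- **Contracting one coordinate costs a logarithm**, in the format of the free sweeps of part
`AllHHRay`: moving the coordinate `i` from `w i` up to `x'` (the other coordinates fixed). -/
theorem lmass_coord_log {ι : Type*} (lo hi : Fin k → Fin k ⊕ ι) (a : Fin k → Option ι)
    (U : Finset ι) (hlo : ∀ i c, lo i = Sum.inr c → c ∈ U) (hhi : ∀ i c, hi i = Sum.inr c → c ∈ U)
    (ha : ∀ i c, a i = some c → c ∈ U) (c₀ : ι → ℝ) (P : Fin D → ι → ℝ) {g R : ℝ} (hg : 0 < g)
    (hR : 0 < R)
    (hsep0 : ∀ c ∈ U, ∀ c' ∈ U, c₀ c ≠ c₀ c' → g ≤ |c₀ c - c₀ c'|)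
    (hsepP : ∀ l, ∀ c ∈ U, ∀ c' ∈ U, P l c ≠ P l c' → g ≤ |P l c - P l c'|)
    (hRP : ∀ l, ∀ c ∈ U, |P l c| ≤ R) (i : Fin D)
    {w : Fin D → ℝ} (hw : ∀ j, 0 < w j ∧ w j ≤ min (1 / 2) (g / (28 * D * R)))
    {x' : ℝ} (hx : w i ≤ x') (hx' : x' ≤ min (1 / 2) (g / (28 * D * R))) :
    lmass lo hi a (nval c₀ P w) ≤
      ENNReal.ofReal (5 * (1 + Real.log (x' / w i))) ^ (k * U.card) *
        lmass lo hi a (nval c₀ P (update w i x')) := by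
  have hwi : 0 < w i := (hw i).1
  have hx'0 : 0 < x' := hwi.trans_le hx
  set σ : ℝ := w i / x' with hσ
  have hσ0 : 0 < σ := div_pos hwi hx'0
  have hσ1 : σ ≤ 1 := (div_le_one hx'0).2 hx
  have hw'' : ∀ j, 0 < update w i x' j ∧ update w i x' j ≤ min (1 / 2) (g / (28 * D * R)) := by
    intro j
    by_cases hj : j = i
    · subst hj; rw [update_self]; exact ⟨hx'0, hx'⟩
    · rw [update_of_ne hj]; exact hw j
  have h := lmass_level_log lo hi a U hlo hhi ha c₀ P hg hR hsep0 hsepP hRP i hw'' hσ0 hσ1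
  have e : update (update w i x') i (σ * update w i x' i) = w := by
    rw [update_self, update_idem, hσ, div_mul_cancel₀ _ hx'0.ne', update_eq_self]
  rw [e, hσ, inv_div] at h
  exact h

/-- **The weight hypotheses for the fibre mass along a nested thin sector of any depth.** See
the module docstring. -/
theorem weight_hyps (lo hi : Fin k → Fin k ⊕ Atm (D + 1)) (a : Fin k → Option (Atm (D + 1)))
    (z₁ : Fin (D + 1) → ℝ) (f : Fin (D + 1) → Fin (D + 1) → ℝ) :
    ∃ ρ₀ > 0, ∃ KΛ : ℝ≥0∞, KΛ ≠ ∞ ∧ ∃ Kn : ℕ, ∃ CΛ : ℝ≥0∞, CΛ ≠ ∞ ∧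
      (∀ w w' : Fin (D + 1) → ℝ, (∀ j, 0 < w j) → (∀ j, w j ≤ w' j) → (∀ j, w' j ≤ 4 * w j) →
        (∀ j, w' j ≤ ρ₀) →
        lmass lo hi a (av (z₁ + npt f w)) ≤ KΛ * lmass lo hi a (av (z₁ + npt f w'))) ∧
      (∀ i, ∀ w : Fin (D + 1) → ℝ, (∀ j, 0 < w j ∧ w j ≤ ρ₀) → ∀ x', w i ≤ x' → x' ≤ ρ₀ →
        lmass lo hi a (av (z₁ + npt f w)) ≤
          CΛ * ENNReal.ofReal ((1 + Real.log (x' / w i)) ^ Kn) *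
            lmass lo hi a (av (z₁ + npt f (update w i x')))) := by
  obtain ⟨U, hlo, hhi, ha⟩ := exists_atoms lo hi a
  set c₀ : Atm (D + 1) → ℝ := fun c => av z₁ c with hc₀
  set P : Fin (D + 1) → Atm (D + 1) → ℝ := fun l c => alin c (f l) with hP
  obtain ⟨g, hg, hsep0, hsepP⟩ := exists_sep_family U c₀ P
  obtain ⟨R, hR, hRP⟩ := exists_bound_family U P
  set Kn := k * U.card with hKn
  refine ⟨min (1 / 2) (g / (28 * (D + 1 : ℕ) * R)), by positivity, (9 : ℝ≥0∞) ^ ((D + 1) * Kn),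
    ENNReal.pow_ne_top (by norm_num), Kn, ENNReal.ofReal (5 ^ Kn), ENNReal.ofReal_ne_top, ?_, ?_⟩
  · intro w w' hw hww' hw'w hw'
    rw [av_npt_eq, av_npt_eq]
    exact lmass_corner_mono_all lo hi a U hlo hhi ha c₀ P hg hR hsep0 hsepP hRP hw hww' hw'w hw'
  · intro i w hw x' hx hx'
    rw [av_npt_eq, av_npt_eq]
    have h := lmass_coord_log lo hi a U hlo hhi ha c₀ P hg hR hsep0 hsepP hRP i hw hx hx'
    rwa [ofReal_five_mul_pow (one_add_log_nonneg (hw i).1 hx)] at h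

/-! ### The weight and its algebra -/

/-- The scalar part of the weight: `jac w / (w^{Dv} |ω w|)`. -/
def phi (Dv : Fin D → ℕ) (ω : (Fin D → ℝ) → ℝ) (w : Fin D → ℝ) : ℝ :=
  jac w / (mono Dv w * |ω w|)

/-- The weight `ofReal (phi) · Λ'`. -/
def wt (Dv : Fin D → ℕ) (ω : (Fin D → ℝ) → ℝ) (Λ' : (Fin D → ℝ) → ℝ≥0∞) (w : Fin D → ℝ) : ℝ≥0∞ :=
  ENNReal.ofReal (phi Dv ω w) * Λ' w

/-- The weight is measurable. -/
theorem measurable_wt (Dv : Fin D → ℕ) {ω : (Fin D → ℝ) → ℝ} (hω : Continuous ω)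
    {Λ' : (Fin D → ℝ) → ℝ≥0∞} (hΛ : Measurable Λ') : Measurable (wt Dv ω Λ') := by
  have h1 : Measurable (phi Dv ω) := by
    unfold phi
    exact continuous_jac.measurable.div (((continuous_mono Dv).mul hω.abs).measurable)
  exact (ENNReal.measurable_ofReal.comp h1).mul hΛ

/-- Powers at ratio `4`. -/
theorem mono_le_four_pow_mul (Dv : Fin D → ℕ) {w w' : Fin D → ℝ} (hw : ∀ j, 0 < w j)
    (hww' : ∀ j, w j ≤ w' j) (hw'w : ∀ j, w' j ≤ 4 * w j) :
    mono Dv w' ≤ (4 : ℝ) ^ (∑ l, Dv l) * mono Dv w := by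
  unfold mono
  rw [← Finset.prod_pow_eq_pow_sum, ← Finset.prod_mul_distrib]
  refine Finset.prod_le_prod (fun l _ => pow_nonneg ((hw l).le.trans (hww' l)) _) fun l _ => ?_
  rw [← mul_pow]
  exact pow_le_pow_left₀ ((hw l).le.trans (hww' l)) (hw'w l) _

/-- The bounds of the regular factor give the ratio bound. -/
theorem omega_ratio' {ω₁ ω₂ ωlo ωhi : ℝ} (hωlo : 0 < ωlo) (h1 : ωlo ≤ ω₁) (h2 : ω₂ ≤ ωhi)
    (h2lo : ωlo ≤ ω₂) : ω₂ ≤ ωhi / ωlo * ω₁ := by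
  rw [div_mul_eq_mul_div, le_div_iff₀ hωlo]
  exact mul_le_mul h2 h1 hωlo.le ((hωlo.trans_le h2lo).le.trans h2)

/-- The ratio inequality for the scalar weight. -/
theorem phi_le {Dv : Fin D → ℕ} {ω : (Fin D → ℝ) → ℝ} {w w' : Fin D → ℝ} {K : ℝ}
    (hnum0 : 0 ≤ jac w) (hnum : jac w ≤ jac w')
    (hden : 0 < mono Dv w * |ω w|) (hden' : 0 < mono Dv w' * |ω w'|)
    (hK : mono Dv w' * |ω w'| ≤ K * (mono Dv w * |ω w|)) :
    phi Dv ω w ≤ K * phi Dv ω w' := by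
  unfold phi
  set den := mono Dv w * |ω w| with hden_def
  set den' := mono Dv w' * |ω w'| with hden'_def
  calc jac w / den ≤ jac w' / den := div_le_div_of_nonneg_right hnum hden.le
    _ = jac w' * (1 / den) := by rw [mul_one_div]
    _ ≤ jac w' * (K / den') := by
        refine mul_le_mul_of_nonneg_left ?_ (hnum0.trans hnum)
        rw [div_le_div_iff₀ hden hden', one_mul]
        exact hK
    _ = K * (jac w' / den') := by ring

section Algebra

variable (Dv : Fin D → ℕ) {ω : (Fin D → ℝ) → ℝ} {Λ' : (Fin D → ℝ) → ℝ≥0∞} {δ : Fin D → ℝ} {ωlo ωhi : ℝ}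
  (hωlo : 0 < ωlo)
  (hω : ∀ w : Fin D → ℝ, (∀ j, 0 < w j ∧ w j < 4 * δ j) → ωlo ≤ |ω w| ∧ |ω w| ≤ ωhi)

include hωlo hω

/-- **The weight is almost decreasing towards the corner** at ratio `4` on the big box. -/
theorem wt_mono (KΛ : ℝ≥0∞)
    (hΛ : ∀ w w' : Fin D → ℝ, (∀ j, 0 < w j) → (∀ j, w j ≤ w' j) → (∀ j, w' j ≤ 4 * w j) →
      (∀ j, w' j < 4 * δ j) → Λ' w ≤ KΛ * Λ' w') :
    ∀ w w' : Fin D → ℝ, (∀ j, 0 < w j) → (∀ j, w j ≤ w' j) → (∀ j, w' j ≤ 4 * w j) →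
      (∀ j, w' j < 4 * δ j) →
      wt Dv ω Λ' w ≤ (ENNReal.ofReal ((4 : ℝ) ^ (∑ l, Dv l) * (ωhi / ωlo)) * KΛ) * wt Dv ω Λ' w' := by
  intro w w' hw hww' hw'w hw'
  have hw'pos : ∀ j, 0 < w' j := fun j => (hw j).trans_le (hww' j)
  obtain ⟨hω1, -⟩ := hω w fun j => ⟨hw j, (hww' j).trans_lt (hw' j)⟩
  obtain ⟨hω1', hω2'⟩ := hω w' fun j => ⟨hw'pos j, hw' j⟩
  have hrat := omega_ratio' hωlo hω1 hω2' hω1'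
  have hωpos : 0 < |ω w| := hωlo.trans_le hω1
  have hωpos' : 0 < |ω w'| := hωlo.trans_le hω1'
  have hm : 0 < mono Dv w := Finset.prod_pos fun l _ => pow_pos (hw l) _
  have hm' : 0 < mono Dv w' := Finset.prod_pos fun l _ => pow_pos (hw'pos l) _
  have hden : 0 < mono Dv w * |ω w| := mul_pos hm hωpos
  have hden' : 0 < mono Dv w' * |ω w'| := mul_pos hm' hωpos'
  have hK : mono Dv w' * |ω w'| ≤ ((4 : ℝ) ^ (∑ l, Dv l) * (ωhi / ωlo)) * (mono Dv w * |ω w|) := by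
    calc mono Dv w' * |ω w'| ≤ ((4 : ℝ) ^ (∑ l, Dv l) * mono Dv w) * (ωhi / ωlo * |ω w|) :=
          mul_le_mul (mono_le_four_pow_mul Dv hw hww' hw'w) hrat hωpos'.le (by positivity)
      _ = _ := by ring
  have hφ := phi_le (jac_nonneg fun j => (hw j).le) (jac_mono (fun j => (hw j).le) hww') hden hden' hK
  unfold wt
  calc ENNReal.ofReal (phi Dv ω w) * Λ' w
      ≤ ENNReal.ofReal (((4 : ℝ) ^ (∑ l, Dv l) * (ωhi / ωlo)) * phi Dv ω w') * (KΛ * Λ' w') :=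
        mul_le_mul (ENNReal.ofReal_le_ofReal hφ) (hΛ w w' hw hww' hw'w hw') zero_le zero_le
    _ = _ := by
        have hωhi : 0 ≤ ωhi / ωlo := div_nonneg (hωpos'.le.trans hω2') hωlo.le
        rw [ENNReal.ofReal_mul (mul_nonneg (pow_nonneg (by norm_num) _) hωhi)]; ring

/-- **Logarithmic cost in a coordinate without explicit power** on the small box. -/
theorem wt_log (i : Fin D) (hDi : Dv i = 0) (Kn : ℕ) (CΛ : ℝ≥0∞)
    (hΛ : ∀ w : Fin D → ℝ, (∀ j, 0 < w j ∧ w j < δ j) → ∀ x', w i ≤ x' → x' < δ i →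
      Λ' w ≤ CΛ * ENNReal.ofReal ((1 + Real.log (x' / w i)) ^ Kn) * Λ' (update w i x')) :
    ∀ w : Fin D → ℝ, (∀ j, 0 < w j ∧ w j < δ j) → ∀ x', w i ≤ x' → x' < δ i →
      wt Dv ω Λ' w ≤ (ENNReal.ofReal (ωhi / ωlo) * CΛ) *
        ENNReal.ofReal ((1 + Real.log (x' / w i)) ^ Kn) * wt Dv ω Λ' (update w i x') := by
  intro w hw x' hx hx'
  have hx'0 : 0 < x' := (hw i).1.trans_le hx
  have hbig : ∀ {y : ℝ} {j : Fin D}, 0 < y → y < δ j → y < 4 * δ j := fun hy h => by linarith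
  have hw' : ∀ j, 0 < update w i x' j ∧ update w i x' j < δ j := by
    intro j
    by_cases hj : j = i
    · subst hj; rw [update_self]; exact ⟨hx'0, hx'⟩
    · rw [update_of_ne hj]; exact hw j
  have hle : ∀ j, w j ≤ update w i x' j := by
    intro j
    by_cases hj : j = i
    · subst hj; rw [update_self]; exact hx
    · rw [update_of_ne hj]
  obtain ⟨hω1, -⟩ := hω w fun j => ⟨(hw j).1, hbig (hw j).1 (hw j).2⟩
  obtain ⟨hω1', hω2'⟩ := hω (update w i x') fun j => ⟨(hw' j).1, hbig (hw' j).1 (hw' j).2⟩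
  have hrat := omega_ratio' hωlo hω1 hω2' hω1'
  have hωpos : 0 < |ω w| := hωlo.trans_le hω1
  have hωpos' : 0 < |ω (update w i x')| := hωlo.trans_le hω1'
  have hm : 0 < mono Dv w := Finset.prod_pos fun l _ => pow_pos (hw l).1 _
  have hmeq : mono Dv (update w i x') = mono Dv w := by
    unfold mono
    refine Finset.prod_congr rfl fun l _ => ?_
    by_cases hl : l = i
    · subst hl; rw [hDi, pow_zero, pow_zero]
    · rw [update_of_ne hl]
  have hden : 0 < mono Dv w * |ω w| := mul_pos hm hωpos
  have hden' : 0 < mono Dv (update w i x') * |ω (update w i x')| := by rw [hmeq]; exact mul_pos hm hωpos'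
  have hK : mono Dv (update w i x') * |ω (update w i x')| ≤ (ωhi / ωlo) * (mono Dv w * |ω w|) := by
    rw [hmeq]
    calc mono Dv w * |ω (update w i x')| ≤ mono Dv w * (ωhi / ωlo * |ω w|) :=
          mul_le_mul_of_nonneg_left hrat hm.le
      _ = _ := by ring
  have hφ := phi_le (jac_nonneg fun j => (hw j).1.le) (jac_mono (fun j => (hw j).1.le) hle) hden hden' hK
  unfold wt
  calc ENNReal.ofReal (phi Dv ω w) * Λ' w
      ≤ ENNReal.ofReal ((ωhi / ωlo) * phi Dv ω (update w i x')) *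
          (CΛ * ENNReal.ofReal ((1 + Real.log (x' / w i)) ^ Kn) * Λ' (update w i x')) :=
        mul_le_mul (ENNReal.ofReal_le_ofReal hφ) (hΛ w hw x' hx hx') zero_le zero_le
    _ = _ := by
        have hωhi : 0 ≤ ωhi / ωlo := div_nonneg (hωpos'.le.trans hω2') hωlo.le
        rw [ENNReal.ofReal_mul hωhi]; ring

end Algebra

/-- **Pointwise conversion of the chart integrand into a piece times the weight.** -/
theorem piece_eq_wt (Dv : Fin D → ℕ) (ω : (Fin D → ℝ) → ℝ) (Λ' : (Fin D → ℝ) → ℝ≥0∞)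
    {w : Fin D → ℝ} (hw : ∀ j, 0 < w j) (hω : ω w ≠ 0) (num cmn : ℝ)
    (hcmn : cmn = mono Dv w * ω w) :
    ENNReal.ofReal (jac w) * (ENNReal.ofReal |num / cmn| * Λ' w) =
      ENNReal.ofReal |num| * wt Dv ω Λ' w := by
  have hm : 0 < mono Dv w := Finset.prod_pos fun l _ => pow_pos (hw l) _
  have hjac : 0 ≤ jac w := jac_nonneg fun j => (hw j).le
  unfold wt phi
  rw [← mul_assoc, ← mul_assoc, ← ENNReal.ofReal_mul hjac, ← ENNReal.ofReal_mul (abs_nonneg _)]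
  congr 2
  rw [hcmn, abs_div, abs_mul, abs_of_pos hm]
  field_simp

end SepAll

/-- **The weight hypotheses for the fibre mass along a nested thin sector of any depth**
(registered part of `stub_separateHigh_hH`; literal form of `SepAll.weight_hyps`): the fibre mass of
a literal Janus fibre datum in blown-up coordinates of a nested sector at `z₁` with frame `f` is, on
a small box, almost decreasing towards the corner at ratio `4` and has a logarithmic contraction
cost in every single coordinate. -/
theorem separateAllHH_weight (k D : ℕ) (lo hi : Fin k → Fin k ⊕ ((Fin (D + 1) → ℚ) × ℚ)) (a : Fin k → Option ((Fin (D + 1) → ℚ) × ℚ)) (z₁ : Fin (D + 1) → ℝ) (f : Fin (D + 1) → Fin (D + 1) → ℝ) : ∃ ρ₀ > 0, ∃ KΛ : ENNReal, KΛ ≠ ⊤ ∧ ∃ Kn : ℕ, ∃ CΛ : ENNReal, CΛ ≠ ⊤ ∧ (∀ w w' : Fin (D + 1) → ℝ, (∀ j, 0 < w j) → (∀ j, w j ≤ w' j) → (∀ j, w' j ≤ 4 * w j) → (∀ j, w' j ≤ ρ₀) → SepTwo.lmass lo hi a (SepTwo.av (z₁ + SepAll.npt f w)) ≤ KΛ *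 SepTwo.lmass lo hi a (SepTwo.av (z₁ + SepAll.npt f w'))) ∧ (∀ i, ∀ w : Fin (D + 1) → ℝ, (∀ j, 0 < w j ∧ w j ≤ ρ₀) → ∀ x', w i ≤ x' → x' ≤ ρ₀ → SepTwo.lmass lo hi a (SepTwo.av (z₁ + SepAll.npt f w)) ≤ CΛ * ENNReal.ofReal ((1 + Real.log (x' / w i)) ^ Kn) * SepTwo.lmass lo hi a (SepTwo.av (z₁ + SepAll.npt f (Function.update w i x')))) := by
  exact SepAll.weight_hyps lo hi a z₁ f

end Summit.KontsevichZagierPeriods.ArrangementNormalForm.JanusBands
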